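import Summits.BirchSwinnertonDyer.BirchSwinnertonDyer.Theorems.GenusKolyvaginAtTwoKFourDepthOneLevelReduction
import Summits.BirchSwinnertonDyer.BirchSwinnertonDyer.Theorems.GenusKolyvaginAtTwoGenusPrimitiveSupplyAtTwoKolyvaginClassAtTwo
import Literature.NumberTheory.EllipticCurves.CasselsTateSelmerFirstCase
import HarnessLib

/-!
# DEPTH-ONE first block, lemma (a): the level-4 Kolyvagin class `c₂(n)` of a Kolyvagin–Heegner datum REDUCES to `c₁(n)`, and if `c₁(n) = 0`
# then `c₂(n) = ι_* t` for a level-2 class `t ∈ H¹(K, E[2])`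

LEAD seat `bsd-line-gk2-p1` g23 (cell `bsd-f1-sign2`), `--supports stmt-BirchSwinnertonDyer-31526 --as helper`.  THEOREMS ONLY (no definition, no named
fact, no `sorry`); route-independent imports.  **BSD is NOT proved by this; nothing is closed.**  Memo: `Cruxes/GenusDeepSupplyAtTwoNegDiscNarrow/
DEPTH-ONE-FIRST-BLOCK-g23.md` §2 (a), §4 (a).

* `map_mulK_kolyvaginClass_two_two` — on the habitat frames (`W/ℚ` globally minimal, `ρ̄_{E,2}` onto, `K` imaginary quadratic with odd `d_K ≠ −3`,
  Heegner hypothesis; `n` a square-free product of Kolyvagin primes at `2` of index `≥ 2` — DEEP — with data at every divisor):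
  **`[2]_* c₂(n) = c₁(n)`** for the top datum (`KolyvaginHeegnerData.kolyvaginClass Nat.prime_two 2 ↦ … 1` under
  `galoisCohomology.map (mulK _ 2 2) 1`; admissibility at `2^M` from `GenusKoly.isAdmissible_pointsSubgroup_two`, invariance mod `4` from
  `KolyCert.toGeomPoints_derivedPoint_mem_invPoints_of_dvd_zhang` at `M = 2`, the cocycle identity from `DepthOne.map_torsionMulBy_kolyvaginClass`).
* `exists_map_inclKD_eq_kolyvaginClass_two_two_of_eq_zero` — hence **`c₁(n) = 0 ⟹ ∃ t ∈ H¹(K, E[2]), ι_* t = c₂(n)`** (exactness of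
  `H¹(E[2]) →ι H¹(E[4]) →[2] H¹(E[2])`, tree `exists_map_inclKD_eq_of_map_mulK_eq_zero_global`).
* prime-level versions `…_prime` for the crux's own data `d₁` (conductor `1`), `d` (conductor `ℓ`).
References: [McCallumLMS1991] §4 (4)–(6), Lemma 4.3; [GrossLMS1991] Prop. 3.6, §4 (4.4); [SerreGaloisCohomology1997] I §2.2.
-/

set_option autoImplicit false
set_option linter.dupNamespace false -- `Summit.<P>.<Sub>` repeats `BirchSwinnertonDyer` (D-0017)

noncomputable section

open scoped Classical

namespace Summit.BirchSwinnertonDyer.BirchSwinnertonDyer.Theorems.GenusSupplyNarrow.DepthOne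

open WeierstrassCurve Field NumberField Literature.NumberTheory.EllipticCurves Literature.NumberTheory.EllipticCurves.KolyvaginCocycle
open Literature.NumberTheory.EllipticCurves.ModularForms Literature.NumberTheory.GaloisRepresentations
open Summit.BirchSwinnertonDyer.Rank1Residual.X11b

-- `K : Type`: the tree's ring-class class field theory is universe `0`.
variable {W : WeierstrassCurve ℚ} [W.IsElliptic] [W.IsGloballyMinimal] [NeZero (W.conductorNorm ℤ)]
  {K : Type} [Field K] [NumberField K]
  {Dt : ModularParametrizationData W (W.conductorNorm ℤ)} {β : ℤ} {ι : K →+* ℂ}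

/-- **`[2]_* c₂(n) = c₁(n)`** for the top datum of a family of Kolyvagin–Heegner data at the divisors of a square-free product `n` of DEEP Kolyvagin primes at `2`
(index `≥ 2`), on the habitat frame (`ρ̄_{E,2}` onto; `K` imaginary quadratic, `d_K` odd `≠ −3`, Heegner).  Both standing inputs discharged at BOTH levels.
[cite: McCallumLMS1991, §4 (4)–(6)] [cite: GrossLMS1991, Prop. 3.6, §4 (4.4)] -/
theorem map_mulK_kolyvaginClass_two_two (hK : IsImaginaryQuadratic K) (hodd : Odd (NumberField.discr K)) (h3 : NumberField.discr K ≠ -3)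
    (hH : SatisfiesHeegnerHypothesis (W.conductorNorm ℤ) K) (hsurj : W.HasSurjectiveModNGaloisRep ((2 : ℤ) ^ 1))
    {n : ℕ} (hn : Squarefree n)
    (hkol : ∀ q ∈ n.primeFactors, Zhang2014.IsKolyvaginPrime (W.conductorNorm ℤ) W K 2 q ∧ 2 ≤ Zhang2014.kolyvaginIndex W 2 q)
    (d : (m : ℕ) → m ∣ n → KolyvaginHeegnerData Dt β ι m) :
    galoisCohomology.map (mulK (W.baseChange K) 2 2) 1 ((d n dvd_rfl).kolyvaginClass Nat.prime_two 2) =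
      (d n dvd_rfl).kolyvaginClass Nat.prime_two 1 := by
  have hA4 : IsAdmissible (absoluteGaloisGroup K) (d n dvd_rfl).pointsSubgroup ((2 ^ 2 : ℕ) : ℤ) :=
    GenusKoly.isAdmissible_pointsSubgroup_two hK hodd hH hsurj hn.ne_zero (d n dvd_rfl) 2
  have hP4 : (d n dvd_rfl).toGeomPoints (d n dvd_rfl).derivedPoint ∈
      invPoints (absoluteGaloisGroup K) (d n dvd_rfl).pointsSubgroup ((2 ^ 2 : ℕ) : ℤ) :=
    Three.KolyCert.toGeomPoints_derivedPoint_mem_invPoints_of_dvd_zhang hK ι Dt Nat.prime_two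
      (GenusKoly.heegner_isCoprime_conductorNorm_discr hK hH) (GenusKoly.discr_lt_neg_four_of_odd hK hodd h3) hn hkol d n dvd_rfl
  have hA2 : IsAdmissible (absoluteGaloisGroup K) (d n dvd_rfl).pointsSubgroup ((2 ^ 1 : ℕ) : ℤ) :=
    GenusKoly.isAdmissible_pointsSubgroup_two hK hodd hH hsurj hn.ne_zero (d n dvd_rfl) 1
  have hP2 : (d n dvd_rfl).toGeomPoints (d n dvd_rfl).derivedPoint ∈
      invPoints (absoluteGaloisGroup K) (d n dvd_rfl).pointsSubgroup ((2 ^ 1 : ℕ) : ℤ) :=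
    Three.KolyCert.toGeomPoints_derivedPoint_mem_invPoints_of_dvd_zhang hK ι Dt Nat.prime_two
      (GenusKoly.heegner_isCoprime_conductorNorm_discr hK hH) (GenusKoly.discr_lt_neg_four_of_odd hK hodd h3) hn
      (fun q hq ↦ ⟨(hkol q hq).1, le_trans (by norm_num) (hkol q hq).2⟩) d n dvd_rfl
  rw [(d n dvd_rfl).kolyvaginClass_of_admissible Nat.prime_two 2 hA4 hP4, (d n dvd_rfl).kolyvaginClass_of_admissible Nat.prime_two 1 hA2 hP2]
  exact map_torsionMulBy_kolyvaginClass (W.baseChange K) (k := 2) (d := 2) hA4 hP4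

/-- **`c₁(n) = 0 ⟹ c₂(n) = ι_* t` for a level-2 class `t`** (exactness of the finite Kummer sequence on `H¹`, tree
`exists_map_inclKD_eq_of_map_mulK_eq_zero_global`). [cite: SerreGaloisCohomology1997, I §2.2] [cite: McCallumLMS1991, §4 (6)] -/
theorem exists_map_inclKD_eq_kolyvaginClass_two_two_of_eq_zero (hK : IsImaginaryQuadratic K) (hodd : Odd (NumberField.discr K))
    (h3 : NumberField.discr K ≠ -3) (hH : SatisfiesHeegnerHypothesis (W.conductorNorm ℤ) K) (hsurj : W.HasSurjectiveModNGaloisRep ((2 : ℤ) ^ 1))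
    {n : ℕ} (hn : Squarefree n)
    (hkol : ∀ q ∈ n.primeFactors, Zhang2014.IsKolyvaginPrime (W.conductorNorm ℤ) W K 2 q ∧ 2 ≤ Zhang2014.kolyvaginIndex W 2 q)
    (d : (m : ℕ) → m ∣ n → KolyvaginHeegnerData Dt β ι m) (h0 : (d n dvd_rfl).kolyvaginClass Nat.prime_two 1 = 0) :
    ∃ t : galoisCohomology ((W.baseChange K).torsionGaloisModule ((2 : ℕ) : ℤ)) 1,
      galoisCohomology.map (inclKD (W.baseChange K) 2 2) 1 t = (d n dvd_rfl).kolyvaginClass Nat.prime_two 2 := by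
  haveI : CharZero K := inferInstance
  have h := map_mulK_kolyvaginClass_two_two hK hodd h3 hH hsurj hn hkol d
  rw [h0] at h
  exact exists_map_inclKD_eq_of_map_mulK_eq_zero_global (W.baseChange K) 2 h

/-- **Prime level, the crux's own data**: for a DEEP Kolyvagin prime `ℓ` at `2` and data `d₁` (conductor `1`), `d` (conductor `ℓ`):
`[2]_* c₂(ℓ) = c₁(ℓ)`. [cite: McCallumLMS1991, §4 (4)–(6)] -/
theorem map_mulK_kolyvaginClass_two_two_prime (hK : IsImaginaryQuadratic K) (hodd : Odd (NumberField.discr K)) (h3 : NumberField.discr K ≠ -3)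
    (hH : SatisfiesHeegnerHypothesis (W.conductorNorm ℤ) K) (hsurj : W.HasSurjectiveModNGaloisRep ((2 : ℤ) ^ 1))
    {ℓ : ℕ} (hKoly : Zhang2014.IsKolyvaginPrime (W.conductorNorm ℤ) W K 2 ℓ) (hdeep : 2 ≤ Zhang2014.kolyvaginIndex W 2 ℓ)
    (d₁ : KolyvaginHeegnerData Dt β ι 1) (d : KolyvaginHeegnerData Dt β ι ℓ) :
    galoisCohomology.map (mulK (W.baseChange K) 2 2) 1 (d.kolyvaginClass Nat.prime_two 2) = d.kolyvaginClass Nat.prime_two 1 := by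
  have hℓ : ℓ.Prime := hKoly.1
  let fam : (m : ℕ) → m ∣ ℓ → KolyvaginHeegnerData Dt β ι m := fun m hm ↦
    if h : m = ℓ then h ▸ d else ((Nat.dvd_prime hℓ).mp hm).resolve_right h ▸ d₁
  have hfam : fam ℓ dvd_rfl = d := by simp [fam]
  have hkol : ∀ q ∈ ℓ.primeFactors, Zhang2014.IsKolyvaginPrime (W.conductorNorm ℤ) W K 2 q ∧ 2 ≤ Zhang2014.kolyvaginIndex W 2 q := by
    intro q hq
    rw [hℓ.primeFactors, Finset.mem_singleton] at hq
    subst hq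
    exact ⟨hKoly, hdeep⟩
  have h := map_mulK_kolyvaginClass_two_two hK hodd h3 hH hsurj hℓ.squarefree hkol fam
  rwa [hfam] at h

/-- **Prime level: `c₁(ℓ) = 0 ⟹ c₂(ℓ) = ι_* t`.** [cite: SerreGaloisCohomology1997, I §2.2] [cite: McCallumLMS1991, §4 (6)] -/
theorem exists_map_inclKD_eq_kolyvaginClass_two_two_of_eq_zero_prime (hK : IsImaginaryQuadratic K) (hodd : Odd (NumberField.discr K))
    (h3 : NumberField.discr K ≠ -3) (hH : SatisfiesHeegnerHypothesis (W.conductorNorm ℤ) K) (hsurj : W.HasSurjectiveModNGaloisRep ((2 : ℤ) ^ 1))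
    {ℓ : ℕ} (hKoly : Zhang2014.IsKolyvaginPrime (W.conductorNorm ℤ) W K 2 ℓ) (hdeep : 2 ≤ Zhang2014.kolyvaginIndex W 2 ℓ)
    (d₁ : KolyvaginHeegnerData Dt β ι 1) (d : KolyvaginHeegnerData Dt β ι ℓ) (h0 : d.kolyvaginClass Nat.prime_two 1 = 0) :
    ∃ t : galoisCohomology ((W.baseChange K).torsionGaloisModule ((2 : ℕ) : ℤ)) 1,
      galoisCohomology.map (inclKD (W.baseChange K) 2 2) 1 t = d.kolyvaginClass Nat.prime_two 2 := by
  haveI : CharZero K := inferInstance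
  have h := map_mulK_kolyvaginClass_two_two_prime hK hodd h3 hH hsurj hKoly hdeep d₁ d
  rw [h0] at h
  exact exists_map_inclKD_eq_of_map_mulK_eq_zero_global (W.baseChange K) 2 h

end Summit.BirchSwinnertonDyer.BirchSwinnertonDyer.Theorems.GenusSupplyNarrow.DepthOne

end
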